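import Summits.RiemannHypothesis.RiemannHypothesis.Theorems.Splittings.ScrewBlaschkeNecessity

/-!
# Shielding: the quantitative form of Blaschke–Borel rigidity

Cell `rh-split`, seat `rh-split-screw-bridge` gen 18; card `cards/SPLIT-screw-bridge.md` §23 (census V121).
ζ-free and RH-free: pure complex analysis; imports the tree file `ScrewBlaschkeNecessity` (p587273; hence
`ScrewBlaschkeRigidity` p584414 and the polygon tower `ScrewLatticeTowerC`).

THE INEQUALITY (`shield_mul_charge_le`).  In the setting of `ScrewBlaschkeRigidity.cluster_charge_eq_zero`
WITHOUT its Blaschke hypothesis — poles `w i` in the open unit disc, absolutely summable charges `b i`, the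
Borel series `Σ b i / (z - w i)` equal on `1 < ‖z‖` to `g - c₀` with `g` holomorphic on `ρ₀ < ‖z‖`, and a
bound `‖g - c₀‖ ≤ M` on one circle `‖z‖ = r₁`, `ρ₀ < r₁ < 1` — for every point `a`, every FINITE set `F` of
indices, and every `N : ℕ`:

  `‖a‖^N · Π_{i ∈ F} ‖bl (w i) a‖ · ‖Σ_{w i = a} b i‖ ≤ r₁^(N+1) · M + Σ_{i ∉ F, w i ≠ a} ‖b i‖ ‖w i‖^N`

(SHIELD × CHARGE ≤ LEAK + TAIL).  It is the Cauchy pairing `ScrewBlaschkeRigidity.pairing_identity` against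
the test function `φ = z^N · Π_{i ∈ F} bl (w i)` with the finite set kept explicit; the tree theorem
`cluster_charge_eq_zero` is its limit under the Blaschke condition, whose only role is to bound the finite
Blaschke products `Π_F ‖bl (w i) a‖` below at `a` uniformly in `F` (`exists_prod_norm_bl_ge`).

CONSEQUENCES (all ζ-free).
* `cluster_charge_eq_zero_of_unshielded` — the fibre charge at `a ≠ 0` vanishes as soon as `a` is
  UNSHIELDED w.r.t. a radius `r₁ ∈ (ρ₀, 1)`: for every `ε > 0` some finite `F` (avoiding the fibre of `a`)
  and some `N` make BOTH the leak `r₁^(N+1)` and the tail `≤ ε · ‖a‖^N Π_F ‖bl (w i) a‖`.  No Blaschke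
  condition is assumed: pole sets whose finite Blaschke products at `a` decay, but slower than the power
  `1 + κ`, `κ = log (1/‖a‖) / log (‖a‖/r₁)`, of the `ℓ¹` tails are still transparent (card §23 (2)).
* `unshielded_of_blaschke` — a Blaschke pole set is unshielded at every `a` with `r₁ < ‖a‖`; so the tree
  theorem is the special case, and on the ζ side `TBL ⟹ UNSH(h)` for every `h > 0`.
* `shield_mul_charge_le_tail` — THE CHARGE–SHIELDING LAW OF BLIND CONFIGURATIONS: if the Borel series
  VANISHES identically outside the closed disc (the lattice-blind class after inversion: Wolff data B14/B16,
  divisor rings B16′, the polygon tower B26), then for every `a` and every finite `F` avoiding its fibre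
  `Π_{i ∈ F} ‖bl (w i) a‖ · ‖Σ_{w i = a} b i‖ ≤ Σ_{i ∉ F, w i ≠ a} ‖b i‖`: a charged pole must be shielded
  by the other poles at least as strongly as the charge left outside any finite set of them — the finite,
  local, quantitative form of `ScrewBlaschkeNecessity` (non-Blaschke accumulation is its `F ↑` limit);
  `shield_mul_charge_le_tail_of_moments` is the same law for moment-cancelling families
  (`Σ b i w i^k = 0`, `k ≥ 1` — the shape of the tree's blind data), and `tower_shielding` reads it on the
  rigid polygon tower B26 (`ScrewLatticeTower.atom/wt`): every atom is shielded by the other atoms at least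
  as strongly as the weight left outside any finite set of them.
* `tail_gt_of_shielded` — THE SHIELDING EXPONENT: if `a` is SHIELDED at a leak radius `r₁ < ‖a‖` (the
  negation of the hypothesis of `cluster_charge_eq_zero_of_unshielded`, with a constant `ε₀ ≤ 1`), then for
  every finite `F` off the fibre `ε₀^(1+κ) ‖a‖ (Π_F ‖bl (w i) a‖)^(1+κ) < Σ_{i∉F, w i≠a} ‖b i‖` with
  `κ = shieldExp a r₁ = log (1/‖a‖) / log (‖a‖/r₁)`: the shields decay at least like the `1/(1+κ)`-th
  power of the charge tails (card §23 (4); on the ζ side this is the `log T` Carleson-sum bound).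
Nothing here bears on the truth of RH.
-/

/-!
## CARVE NOTE (rh-split-typer-2 g7, lane «SHIELDING», lead RULINGS #413/#416, 2026-08-28)

PART A = §§1–3 (`shield_mul_charge_le`, `cluster_charge_eq_zero_of_unshielded`, `unshielded_of_blaschke`,
`shield_mul_charge_le_tail`) of OBJECT #6 `HOME/rh-split-screw-bridge/g18/ScrewBlaschkeShielding.lean` (sha16 42c937ecda46d634,
497 lines; author seat rh-split-screw-bridge g18; referee rh-split-ref-2 g7 §23 PASS), cut at the declaration boundary before the
section header «## 4.» (source l.298) because tree files with proofs are ≤ 400 lines (gate `lint.statement-form`): source lines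
1–297 are reproduced BYTE-IDENTICALLY above this note's position (module docstring, imports, preamble, §§1–3); PART B
(`Splittings/ScrewBlaschkeShielding.lean`, §§4–5: `shield_mul_charge_le_tail_of_moments`, `tower_shielding`, `shieldExp`,
`tail_gt_of_shielded`) imports this file and re-opens the namespace `…Theorems.Splittings.ScrewBlaschkeShielding`, so every
fully-qualified name is unchanged and OBJECT #7's `import …ScrewBlaschkeShielding` sees all of #6.  No statement, proof or
docstring byte of any declaration was changed.  Nothing here bears on the truth of RH.
-/

noncomputable section

set_option linter.dupNamespace false

open Complex Metric Set Filter Topology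
open scoped Real ComplexConjugate
open Summit.RiemannHypothesis.RiemannHypothesis.Theorems.Splittings
open Summit.RiemannHypothesis.RiemannHypothesis.Theorems.Splittings.ScrewBlaschkeRigidity

namespace Summit.RiemannHypothesis.RiemannHypothesis.Theorems.Splittings.ScrewBlaschkeShielding

/-! ## 1. The finite pairing inequality: shield × charge ≤ leak + tail -/

/-- **Shield × charge ≤ leak + tail.**  For an `ℓ¹` Borel series `Σ b i / (z - w i)` (poles in the unit disc)
that equals `g - c₀` on `1 < ‖z‖`, `g` holomorphic on `ρ₀ < ‖z‖`, `‖g - c₀‖ ≤ M` on `‖z‖ = r₁ ∈ (ρ₀, 1)`: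
`‖a‖^N · Π_{i∈F} ‖bl (w i) a‖ · ‖Σ_{w i = a} b i‖ ≤ r₁^(N+1) M + Σ_{i ∉ F, w i ≠ a} ‖b i‖ ‖w i‖^N` for every
point `a`, every finite `F`, every `N` (if `F` meets the fibre of `a` the shield vanishes and the inequality
is trivial).  No Blaschke condition. -/
theorem shield_mul_charge_le {ι : Type*} [Countable ι] {w b : ι → ℂ} {ρ₀ : ℝ} {g : ℂ → ℂ}
    {c₀ : ℂ} (hρ₀ : 0 ≤ ρ₀) (hw : ∀ i, ‖w i‖ < 1) (hb : Summable fun i ↦ ‖b i‖)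
    (hg : DifferentiableOn ℂ g {z : ℂ | ρ₀ < ‖z‖})
    (heq : ∀ z : ℂ, 1 < ‖z‖ → HasSum (fun i ↦ b i / (z - w i)) (g z - c₀))
    {r₁ M : ℝ} (hr₁ρ : ρ₀ < r₁) (hr₁1 : r₁ < 1) (hM : ∀ z : ℂ, ‖z‖ = r₁ → ‖g z - c₀‖ ≤ M)
    (a : ℂ) (F : Finset ι) (N : ℕ) :
    ‖a‖ ^ N * (∏ i ∈ F, ‖bl (w i) a‖) * ‖∑' i : {i // w i = a}, b i‖ ≤
      r₁ ^ (N + 1) * M + ∑' i : {i // i ∉ F ∧ w i ≠ a}, ‖b i‖ * ‖w i‖ ^ N := by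
  classical
  show ‖a‖ ^ N * (∏ i ∈ F, ‖bl (w i) a‖) * ‖∑' i : ({i | w i = a} : Set ι), b i‖ ≤
      r₁ ^ (N + 1) * M + ∑' i : ({i | i ∉ F ∧ w i ≠ a} : Set ι), ‖b (i : ι)‖ * ‖w (i : ι)‖ ^ N
  set s : ℂ := ∑' i : ({i | w i = a} : Set ι), b i with hs_def
  have hr₁0 : 0 < r₁ := lt_of_le_of_lt hρ₀ hr₁ρ
  -- `G := g - c₀`, holomorphic on `ρ₀ < ‖z‖`
  set G : ℂ → ℂ := fun z ↦ g z - c₀ with hG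
  have hUopen : IsOpen {z : ℂ | ρ₀ < ‖z‖} := isOpen_lt continuous_const continuous_norm
  have hGd : DifferentiableOn ℂ G {z : ℂ | ρ₀ < ‖z‖} := hg.sub_const c₀
  have hGat : ∀ z : ℂ, ρ₀ < ‖z‖ → DifferentiableAt ℂ G z := fun z hz ↦
    hGd.differentiableAt (hUopen.mem_nhds hz)
  have heq' : ∀ z : ℂ, 1 < ‖z‖ → HasSum (fun i ↦ b i / (z - w i)) (G z) := heq
  set φ : ℂ → ℂ := phi w F N with hφ
  -- (i) the pairing identity and (ii) the bound on the circle `‖z‖ = r₁`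
  have ident : ∑' i, b i * φ (w i) = (2 * π * I)⁻¹ • ∮ z in C(0, r₁), φ z * G z :=
    pairing_identity hρ₀ hw hb hGat heq' F N hr₁ρ hr₁1
  have rhs_bound : ‖(2 * π * I : ℂ)⁻¹ • ∮ z in C(0, r₁), φ z * G z‖ ≤ r₁ * (r₁ ^ N * M) := by
    refine circleIntegral.norm_two_pi_i_inv_smul_integral_le_of_norm_le_const hr₁0.le ?_
    intro z hz
    have hz' : ‖z‖ = r₁ := by simpa [hr₁0.le, abs_of_pos hr₁0] using hz
    rw [norm_mul]
    have h1 : ‖φ z‖ ≤ r₁ ^ N := by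
      have := norm_phi_le hw F N (z := z) (by rw [hz']; exact hr₁1.le)
      rwa [hz'] at this
    exact mul_le_mul h1 (hM z hz') (norm_nonneg _) (pow_nonneg hr₁0.le _)
  -- (iii) split the paired family: `b i φ(w i) = f₁ i + f₂ i`
  have hφw : ∀ i, ‖φ (w i)‖ ≤ ‖w i‖ ^ N := fun i ↦ norm_phi_le hw F N (hw i).le
  set f₁ : ι → ℂ := ({i | w i = a} : Set ι).indicator (fun i ↦ b i * φ a) with hf₁
  set f₂ : ι → ℂ := ({i | i ∉ F ∧ w i ≠ a} : Set ι).indicator (fun i ↦ b i * φ (w i)) with hf₂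
  have hdecomp : (fun i ↦ b i * φ (w i)) = fun i ↦ f₁ i + f₂ i := by
    funext i
    simp only [hf₁, hf₂, Set.indicator_apply, Set.mem_setOf_eq]
    by_cases h1 : w i = a
    · simp [h1]
    · by_cases h2 : i ∈ F
      · have : φ (w i) = 0 := phi_apply_eq_zero h2
        simp [h1, h2, this]
      · simp [h1, h2]
  have hf₁s : Summable f₁ := by
    refine (hb.mul_right ‖φ a‖).of_norm_bounded fun i ↦ ?_
    simp only [hf₁, Set.indicator_apply, Set.mem_setOf_eq]
    split_ifs with h
    · rw [norm_mul]
    · rw [norm_zero]; exact mul_nonneg (norm_nonneg _) (norm_nonneg _)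
  have hbN : Summable fun i ↦ ‖b i‖ * ‖w i‖ ^ N :=
    hb.of_nonneg_of_le (fun i ↦ mul_nonneg (norm_nonneg _) (pow_nonneg (norm_nonneg _) _))
      (fun i ↦ mul_le_of_le_one_right (norm_nonneg _) (pow_le_one₀ (norm_nonneg _) (hw i).le))
  have hf₂le : ∀ i, ‖f₂ i‖ ≤
      ({i | i ∉ F ∧ w i ≠ a} : Set ι).indicator (fun i ↦ ‖b i‖ * ‖w i‖ ^ N) i := by
    intro i
    simp only [hf₂, Set.indicator_apply, Set.mem_setOf_eq]
    split_ifs with h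
    · rw [norm_mul]; exact mul_le_mul_of_nonneg_left (hφw i) (norm_nonneg _)
    · rw [norm_zero]
  have hind_s : Summable (({i | i ∉ F ∧ w i ≠ a} : Set ι).indicator (fun i ↦ ‖b i‖ * ‖w i‖ ^ N)) :=
    hbN.indicator _
  have hf₂s : Summable f₂ := hind_s.of_norm_bounded hf₂le
  have hsum₁ : ∑' i, f₁ i = φ a * s := by
    have h1 : ∑' i, f₁ i = ∑' i : ({i | w i = a} : Set ι), b i * φ a := (tsum_subtype _ _).symm
    rw [h1, tsum_mul_right, mul_comm]
  have hsplit : ∑' i, b i * φ (w i) = φ a * s + ∑' i, f₂ i := by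
    rw [hdecomp, (hf₁s.hasSum.add hf₂s.hasSum).tsum_eq, hsum₁]
  have htail : ‖∑' i, f₂ i‖ ≤
      ∑' i : ({i | i ∉ F ∧ w i ≠ a} : Set ι), ‖b (i : ι)‖ * ‖w (i : ι)‖ ^ N := by
    calc ‖∑' i, f₂ i‖ ≤ ∑' i, ‖f₂ i‖ := norm_tsum_le_tsum_norm hf₂s.norm
      _ ≤ ∑' i, ({i | i ∉ F ∧ w i ≠ a} : Set ι).indicator (fun i ↦ ‖b i‖ * ‖w i‖ ^ N) i :=
          hf₂s.norm.tsum_le_tsum hf₂le hind_s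
      _ = ∑' i : ({i | i ∉ F ∧ w i ≠ a} : Set ι), ‖b (i : ι)‖ * ‖w (i : ι)‖ ^ N :=
          (tsum_subtype _ _).symm
  -- (iv) combine
  have hφa : ‖φ a‖ = ‖a‖ ^ N * ∏ i ∈ F, ‖bl (w i) a‖ := norm_phi w F N a
  calc ‖a‖ ^ N * (∏ i ∈ F, ‖bl (w i) a‖) * ‖s‖ = ‖φ a * s‖ := by rw [norm_mul, hφa]
    _ = ‖∑' i, b i * φ (w i) - ∑' i, f₂ i‖ := by rw [hsplit, add_sub_cancel_right]
    _ ≤ ‖∑' i, b i * φ (w i)‖ + ‖∑' i, f₂ i‖ := norm_sub_le _ _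
    _ ≤ r₁ * (r₁ ^ N * M) +
        ∑' i : ({i | i ∉ F ∧ w i ≠ a} : Set ι), ‖b (i : ι)‖ * ‖w (i : ι)‖ ^ N :=
          add_le_add (by rw [ident]; exact rhs_bound) htail
    _ = r₁ ^ (N + 1) * M +
        ∑' i : ({i | i ∉ F ∧ w i ≠ a} : Set ι), ‖b (i : ι)‖ * ‖w (i : ι)‖ ^ N := by ring

/-! ## 2. Unshielded points carry no charge

`UNSH(w, b; a, r₁)` («the point `a` is UNSHIELDED by the poles `w` with charges `b` at leak radius `r₁`»; spelled
out in the hypothesis `hun` below and in the conclusion of `unshielded_of_blaschke` — no predicate is defined, the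
ζ-side names it `ScrewShieldingSeam.TopUnshielded`): for every `ε > 0` some finite set `F` of indices with
`w i ≠ a` on `F` and some `N : ℕ` make both the LEAK `r₁^(N+1)` and the TAIL `Σ_{i ∉ F, w i ≠ a} ‖b i‖ ‖w i‖^N`
at most `ε · ‖a‖^N · Π_{i∈F} ‖bl (w i) a‖` (`ε` times the SHIELD). -/

/-- **Quantitative Blaschke–Borel rigidity.**  In the setting of `shield_mul_charge_le`, if the point
`a ≠ 0` of the disc is UNSHIELDED (`hun`) at some leak radius `r₁ ∈ (ρ₀, 1)`, then the fibre charge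
`Σ_{w i = a} b i` vanishes: by `shield_mul_charge_le`, SHIELD · ‖charge‖ ≤ ε · SHIELD · (M + 1) for every
`ε > 0`, and the shield is positive.
No Blaschke condition (cf. `ScrewBlaschkeRigidity.cluster_charge_eq_zero`, the special case
`unshielded_of_blaschke`). -/
theorem cluster_charge_eq_zero_of_unshielded {ι : Type*} [Countable ι] {w b : ι → ℂ} {ρ₀ : ℝ}
    {g : ℂ → ℂ} {c₀ : ℂ} (hρ₀ : 0 ≤ ρ₀) (hw : ∀ i, ‖w i‖ < 1) (hb : Summable fun i ↦ ‖b i‖)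
    (hg : DifferentiableOn ℂ g {z : ℂ | ρ₀ < ‖z‖})
    (heq : ∀ z : ℂ, 1 < ‖z‖ → HasSum (fun i ↦ b i / (z - w i)) (g z - c₀))
    {a : ℂ} (ha0 : a ≠ 0) (ha1 : ‖a‖ < 1) {r₁ : ℝ} (hr₁ρ : ρ₀ < r₁) (hr₁1 : r₁ < 1)
    (hun : ∀ ε : ℝ, 0 < ε → ∃ F : Finset ι, (∀ i ∈ F, w i ≠ a) ∧ ∃ N : ℕ,
      r₁ ^ (N + 1) ≤ ε * (‖a‖ ^ N * ∏ i ∈ F, ‖bl (w i) a‖) ∧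
      ∑' i : {i // i ∉ F ∧ w i ≠ a}, ‖b i‖ * ‖w i‖ ^ N ≤
        ε * (‖a‖ ^ N * ∏ i ∈ F, ‖bl (w i) a‖)) :
    ∑' i : {i // w i = a}, b i = 0 := by
  classical
  set s : ℂ := ∑' i : {i // w i = a}, b i with hs_def
  have hr₁0 : 0 < r₁ := lt_of_le_of_lt hρ₀ hr₁ρ
  -- a bound `M ≥ 0` for `g - c₀` on the circle `‖z‖ = r₁`
  obtain ⟨M, hM0, hM⟩ : ∃ M : ℝ, 0 ≤ M ∧ ∀ z : ℂ, ‖z‖ = r₁ → ‖g z - c₀‖ ≤ M := by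
    have hUopen : IsOpen {z : ℂ | ρ₀ < ‖z‖} := isOpen_lt continuous_const continuous_norm
    have hc : ContinuousOn (fun z ↦ g z - c₀) (sphere (0 : ℂ) r₁) := by
      refine (hg.sub_const c₀).continuousOn.mono fun z hz ↦ ?_
      have hz' : ‖z‖ = r₁ := mem_sphere_zero_iff_norm.1 hz
      show ρ₀ < ‖z‖
      rw [hz']; exact hr₁ρ
    obtain ⟨M, hM⟩ := (isCompact_sphere (0 : ℂ) r₁).exists_bound_of_continuousOn hc
    exact ⟨max M 0, le_max_right _ _, fun z hz ↦
      (hM z (mem_sphere_zero_iff_norm.2 hz)).trans (le_max_left _ _)⟩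
  have key : ∀ ε : ℝ, 0 < ε → ‖s‖ ≤ ε * (M + 1) := by
    intro ε hε
    obtain ⟨F, hF, N, h1, h2⟩ := hun ε hε
    set Q : ℝ := ‖a‖ ^ N * ∏ i ∈ F, ‖bl (w i) a‖ with hQ
    have hQ0 : 0 < Q := mul_pos (pow_pos (norm_pos_iff.2 ha0) N)
      (Finset.prod_pos fun i hi ↦ norm_bl_pos (hw i) ha1 (hF i hi))
    have hmain := shield_mul_charge_le hρ₀ hw hb hg heq hr₁ρ hr₁1 hM a F N
    have h3 : Q * ‖s‖ ≤ Q * (ε * (M + 1)) := by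
      calc Q * ‖s‖ = ‖a‖ ^ N * (∏ i ∈ F, ‖bl (w i) a‖) * ‖s‖ := by rw [hQ]
        _ ≤ r₁ ^ (N + 1) * M + ∑' i : {i // i ∉ F ∧ w i ≠ a}, ‖b i‖ * ‖w i‖ ^ N := hmain
        _ ≤ ε * Q * M + ε * Q := add_le_add (mul_le_mul_of_nonneg_right h1 hM0) h2
        _ = Q * (ε * (M + 1)) := by ring
    exact le_of_mul_le_mul_left h3 hQ0
  have hs0 : ‖s‖ ≤ 0 := by
    refine le_of_forall_pos_le_add fun ε hε ↦ ?_
    have hM1 : (0 : ℝ) < M + 1 := by linarith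
    have := key (ε / (M + 1)) (div_pos hε hM1)
    rw [div_mul_cancel₀ _ hM1.ne'] at this
    linarith
  exact norm_le_zero_iff.1 hs0

/-- **Blaschke pole sets are unshielded** at every point `a` of the disc with `r₁ < ‖a‖` (`0 ≤ r₁`): the
finite Blaschke products at `a` are bounded below uniformly (`exists_prod_norm_bl_ge`, the only use of the
Blaschke condition), the leak `r₁^(N+1)` is `o(‖a‖^N)`, and the `ℓ¹` tails tend to `0`.  Hence
`cluster_charge_eq_zero_of_unshielded` contains the tree theorem `cluster_charge_eq_zero`. -/
theorem unshielded_of_blaschke {ι : Type*} {w b : ι → ℂ} (hw : ∀ i, ‖w i‖ < 1)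
    (hbl : Summable fun i ↦ 1 - ‖w i‖) (hb : Summable fun i ↦ ‖b i‖) {a : ℂ} (ha1 : ‖a‖ < 1)
    {r₁ : ℝ} (hr₁0 : 0 ≤ r₁) (hr₁a : r₁ < ‖a‖) (ε : ℝ) (hε : 0 < ε) :
    ∃ F : Finset ι, (∀ i ∈ F, w i ≠ a) ∧ ∃ N : ℕ,
      r₁ ^ (N + 1) ≤ ε * (‖a‖ ^ N * ∏ i ∈ F, ‖bl (w i) a‖) ∧
      ∑' i : {i // i ∉ F ∧ w i ≠ a}, ‖b i‖ * ‖w i‖ ^ N ≤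
        ε * (‖a‖ ^ N * ∏ i ∈ F, ‖bl (w i) a‖) := by
  classical
  have ha0 : 0 < ‖a‖ := lt_of_le_of_lt hr₁0 hr₁a
  obtain ⟨c, hc0, hc⟩ := exists_prod_norm_bl_ge hw hbl ha1
  -- `N` with `r₁ (r₁/‖a‖)^N < ε c`
  have hθ1 : r₁ / ‖a‖ < 1 := (div_lt_one ha0).2 hr₁a
  have hθ0 : 0 ≤ r₁ / ‖a‖ := div_nonneg hr₁0 ha0.le
  obtain ⟨N, hN⟩ : ∃ N : ℕ, r₁ * (r₁ / ‖a‖) ^ N < ε * c := by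
    have ht : Tendsto (fun N : ℕ ↦ r₁ * (r₁ / ‖a‖) ^ N) atTop (𝓝 0) := by
      simpa using (tendsto_pow_atTop_nhds_zero_of_lt_one hθ0 hθ1).const_mul r₁
    exact (ht.eventually (gt_mem_nhds (mul_pos hε hc0))).exists
  have haN : 0 < ‖a‖ ^ N := pow_pos ha0 N
  -- `F` with `ℓ¹` tail `< ε c ‖a‖^N`
  obtain ⟨T₀, hT₀⟩ : ∃ T₀ : Finset ι, ∑' i : {x // x ∉ T₀}, ‖b i‖ < ε * c * ‖a‖ ^ N :=
    ((tendsto_tsum_compl_atTop_zero (fun i ↦ ‖b i‖)).eventually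
      (gt_mem_nhds (by positivity))).exists
  have hT₀' : ∑' i : ({x | x ∉ T₀} : Set ι), ‖b (i : ι)‖ < ε * c * ‖a‖ ^ N := hT₀
  set F : Finset ι := T₀.filter (fun i ↦ w i ≠ a) with hF
  have hFa : ∀ i ∈ F, w i ≠ a := fun i hi ↦ (Finset.mem_filter.1 hi).2
  have hP : c ≤ ∏ i ∈ F, ‖bl (w i) a‖ := hc F hFa
  have hcQ : ε * c * ‖a‖ ^ N ≤ ε * (‖a‖ ^ N * ∏ i ∈ F, ‖bl (w i) a‖) := by
    calc ε * c * ‖a‖ ^ N = ε * ‖a‖ ^ N * c := by ring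
      _ ≤ ε * ‖a‖ ^ N * ∏ i ∈ F, ‖bl (w i) a‖ := mul_le_mul_of_nonneg_left hP (by positivity)
      _ = ε * (‖a‖ ^ N * ∏ i ∈ F, ‖bl (w i) a‖) := by ring
  refine ⟨F, hFa, N, ?_, ?_⟩
  · have hpow : (r₁ / ‖a‖) ^ N * ‖a‖ ^ N = r₁ ^ N := by
      rw [div_pow, div_mul_cancel₀ _ haN.ne']
    calc r₁ ^ (N + 1) = r₁ * (r₁ / ‖a‖) ^ N * ‖a‖ ^ N := by rw [pow_succ', mul_assoc, hpow]
      _ ≤ ε * c * ‖a‖ ^ N := mul_le_mul_of_nonneg_right hN.le haN.le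
      _ ≤ ε * (‖a‖ ^ N * ∏ i ∈ F, ‖bl (w i) a‖) := hcQ
  · show ∑' i : ({i | i ∉ F ∧ w i ≠ a} : Set ι), ‖b (i : ι)‖ * ‖w (i : ι)‖ ^ N ≤
        ε * (‖a‖ ^ N * ∏ i ∈ F, ‖bl (w i) a‖)
    have hbN : Summable fun i ↦ ‖b i‖ * ‖w i‖ ^ N :=
      hb.of_nonneg_of_le (fun i ↦ mul_nonneg (norm_nonneg _) (pow_nonneg (norm_nonneg _) _))
        (fun i ↦ mul_le_of_le_one_right (norm_nonneg _) (pow_le_one₀ (norm_nonneg _) (hw i).le))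
    have hsub : ({i | i ∉ F ∧ w i ≠ a} : Set ι) ⊆ {i | i ∉ T₀} := by
      intro i hi hT
      exact hi.1 (Finset.mem_filter.2 ⟨hT, hi.2⟩)
    have hle : ∀ i, ({i | i ∉ F ∧ w i ≠ a} : Set ι).indicator (fun i ↦ ‖b i‖ * ‖w i‖ ^ N) i ≤
        ({i | i ∉ T₀} : Set ι).indicator (fun i ↦ ‖b i‖) i := fun i ↦
      (Set.indicator_le_indicator_of_subset hsub
        (fun j ↦ mul_nonneg (norm_nonneg _) (pow_nonneg (norm_nonneg _) _)) i).trans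
        (Set.indicator_le_indicator (mul_le_of_le_one_right (norm_nonneg _)
          (pow_le_one₀ (norm_nonneg _) (hw i).le)))
    calc ∑' i : ({i | i ∉ F ∧ w i ≠ a} : Set ι), ‖b (i : ι)‖ * ‖w (i : ι)‖ ^ N
        = ∑' i, ({i | i ∉ F ∧ w i ≠ a} : Set ι).indicator (fun i ↦ ‖b i‖ * ‖w i‖ ^ N) i :=
          tsum_subtype ({i | i ∉ F ∧ w i ≠ a} : Set ι) (fun i ↦ ‖b i‖ * ‖w i‖ ^ N)
      _ ≤ ∑' i, ({i | i ∉ T₀} : Set ι).indicator (fun i ↦ ‖b i‖) i :=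
          (hbN.indicator _).tsum_le_tsum hle (hb.indicator _)
      _ = ∑' i : ({x | x ∉ T₀} : Set ι), ‖b (i : ι)‖ := (tsum_subtype _ _).symm
      _ ≤ ε * c * ‖a‖ ^ N := hT₀'.le
      _ ≤ ε * (‖a‖ ^ N * ∏ i ∈ F, ‖bl (w i) a‖) := hcQ

/-! ## 3. The charge–shielding law of blind configurations -/

/-- **Charge–shielding law.**  If an `ℓ¹` Borel series with poles in the unit disc VANISHES identically on
`1 < ‖z‖` (a blind configuration), then for every point `a` and every finite set `F` of indices:
`Π_{i∈F} ‖bl (w i) a‖ · ‖Σ_{w i = a} b i‖ ≤ Σ_{i ∉ F, w i ≠ a} ‖b i‖` — the charge at `a`,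
damped by the finite Blaschke product of any finite set of other poles, is at most the charge outside
that set.  (`shield_mul_charge_le` with `g = 0`, `ρ₀ = 0`, `N = 0`.) -/
theorem shield_mul_charge_le_tail {ι : Type*} [Countable ι] {w b : ι → ℂ} (hw : ∀ i, ‖w i‖ < 1)
    (hb : Summable fun i ↦ ‖b i‖)
    (hblind : ∀ z : ℂ, 1 < ‖z‖ → HasSum (fun i ↦ b i / (z - w i)) 0)
    (a : ℂ) (F : Finset ι) :
    (∏ i ∈ F, ‖bl (w i) a‖) * ‖∑' i : {i // w i = a}, b i‖ ≤
      ∑' i : {i // i ∉ F ∧ w i ≠ a}, ‖b i‖ := by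
  have heq : ∀ z : ℂ, 1 < ‖z‖ →
      HasSum (fun i ↦ b i / (z - w i)) ((fun _ : ℂ ↦ (0 : ℂ)) z - 0) := fun z hz ↦ by
    simpa using hblind z hz
  have hM : ∀ z : ℂ, ‖z‖ = 1 / 2 → ‖(fun _ : ℂ ↦ (0 : ℂ)) z - 0‖ ≤ 0 := fun z _ ↦ by simp
  have h := shield_mul_charge_le (ρ₀ := 0) (r₁ := 1 / 2) le_rfl hw hb (differentiableOn_const 0)
    heq (by norm_num) (by norm_num) hM a F 0
  simpa using h


end Summit.RiemannHypothesis.RiemannHypothesis.Theorems.Splittings.ScrewBlaschkeShielding
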